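import Mathlib
import HarnessLib
import Summits.ResolutionOfSingularities.ResolutionOfSingularities.Theorems.WildQuotientsWildQuotientResolutionS1aSymCover
import Summits.ResolutionOfSingularities.ResolutionOfSingularities.Theorems.WildQuotientsWildQuotientResolutionS1aNodeCentre

/-!
# S1a — THE SYMMETRIC ROOT MOVE: cover elements as identities in `R^w`, residual sections, chart-transition pins, and a disjointness tool

[OURS · L1 W4.5c · lead-1 g15; R3 brick 4 (after ✓`…S1aSymRoot`, ✓`…S1aSymCover`); pattern ✓`…S1aA1Cover` §Sections / ✓`a1_section_pin`] — NOT statements of the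
manuscript; counted 0; AI-level work, weaker than expert review. Crux stmt-ResolutionOfSingularities-17941 `CyclicQuotientFourfolds`, line `s1a-logminvertex` v13
(`stub_reachLowerInFX`). Centre `f = e⁻¹(x₀, x₁, x₂)`, weights `(δ+1, 1, 1)`, tail `x₁·r` (`e⁻¹r ∈ 𝒥_{δ−1}`), cover degree `dbar = d·((δ+1)δp)`.
* generic (`BlowupCharts`, any node/centre): `coverElement_mem_reesPiece` (bidegree `(dbar, 0)`), ★ `coverElement_section_pin` (the transition section
  `c′/c` of two cover elements of one degree satisfies `(c′/c) · T(y) = T(y′)` in the chart ring of `c` — the input of ✓`symm_mul_appLE_eq_of_pin`);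
  (`GoodCharts`) ★ `disjoint_closure_zeroLocus_of_section` (an open `U` with a section `t` on `W`, a unit on `W ∩ U`, some power of which lies in `S`, is
  disjoint from `closure (V_W(S) ∩ W)` — the `hWoff`/`hdisj` input of the parallel kill leaf ✓`killsIn_one_of_disjointPrincipalFamily`);
* symmetric root: `sym_coverElement_zero_eq` (`c₀ = u₀′^{δdp}`), `sym_coverElement_norm_eq` (`c_j = (∏ᵢ (u_j′ + i·u₀′s^δ))^{(δ+1)δd}`), bidegrees
  `sym_u'_zero_pow_mem_reesPiece`, `sym_u'_one_mul_tail_pow_mem_reesPiece`, and the residual sections ★ `sym_residualSection_zero` (`u₀′^{δdp}/c`),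
  ★ `sym_residualSection_one` (`(u₁′·r t^{δ−1})^{(δ+1)dp}/c`) — degree `0` and in `𝔞·R_c` for any ideal `𝔞` containing `u₀′` resp. `u₁′·r t^{δ−1}`.
-/

set_option linter.dupNamespace false

noncomputable section

open CategoryTheory Limits AlgebraicGeometry TopologicalSpace Topology Opposite
open Literature.AlgebraicGeometry.Resolution
open scoped LaurentPolynomial
open MvPolynomial
open Summit.ResolutionOfSingularities.ResolutionOfSingularities.Theorems.WildQuotientResolution.S1
open Summit.ResolutionOfSingularities.ResolutionOfSingularities.Theorems.WildQuotientResolution.S1.CoarseChart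
open Summit.ResolutionOfSingularities.ResolutionOfSingularities.Theorems.WildQuotientResolution.S1.ProducerStep
open Summit.ResolutionOfSingularities.ResolutionOfSingularities.Theorems.WildQuotientResolution.S1.ReesBigrading
open Summit.ResolutionOfSingularities.ResolutionOfSingularities.Theorems.WildQuotientResolution.S1.BlowupCharts

/-! ## Generic: cover elements, transition pins, disjointness -/

namespace Summit.ResolutionOfSingularities.ResolutionOfSingularities.Theorems.WildQuotientResolution.S1.BlowupCharts

universe u

section Generic

variable {m : ℕ} (r : Fin m → ℕ) {B : Type u} [CommRing B] (𝒜 : (Π j : Fin m, ZMod (r j)) → AddSubgroup B) [GradedRing 𝒜] {c : ℕ}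
  (f : Fin c → B) {δ : Fin c → Π j : Fin m, ZMod (r j)} (w : Fin c → ℕ) (hf : ∀ i, f i ∈ 𝒜 (δ i))
  {dbar : ℕ} (y : ↥(𝒜 0)) (hy : y ∈ (traceFiltration 𝒜 f w).ideal dbar)

/-- A cover element `y′T^{dbar}` has bidegree `(dbar, 0)`. -/
theorem coverElement_mem_reesPiece (y' : ↥(𝒜 0)) (hy' : y' ∈ (traceFiltration 𝒜 f w).ideal dbar) :
    coverElement 𝒜 f w dbar y' hy' ∈ reesPiece 𝒜 f w ((dbar : ℤ), (0 : Π j : Fin m, ZMod (r j))) :=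
  ⟨y', y'.2, by rw [coe_coverElement]⟩

/-- ★ **The transition section `c′/c`** of two cover elements of one degree is a degree-0 element of the chart ring of `c`. -/
theorem transitionSection_mem_chartNodeGrading_zero (y' : ↥(𝒜 0)) (hy' : y' ∈ (traceFiltration 𝒜 f w).ideal dbar) :
    algebraMap _ (ChartRing 𝒜 f w dbar y hy) (coverElement 𝒜 f w dbar y' hy') * IsLocalization.Away.invSelf (coverElement 𝒜 f w dbar y hy) ∈
      chartNodeGrading r 𝒜 f w hf dbar y hy 0 :=
  residualSection_mem_chartNodeGrading_zero r 𝒜 f w hf y hy (coverElement_mem_reesPiece r 𝒜 f w y' hy')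

/-- ★ **Pin of a residual section**: if `v · C(y) = C(y′) · c` in `R^w` (`c = yT^{dbar}`), then `(v/c) · T(y) = T(y′)` in the chart ring of `c`. -/
theorem residualSection_pin (v : ↥(cobordantAlgebra f w)) (y' : ↥(𝒜 0))
    (hv : v * algebraMap B _ (y : B) = algebraMap B _ (y' : B) * coverElement 𝒜 f w dbar y hy) :
    (algebraMap _ (ChartRing 𝒜 f w dbar y hy) v * IsLocalization.Away.invSelf (coverElement 𝒜 f w dbar y hy)) * toChartRing 𝒜 f w dbar y hy y =
      toChartRing 𝒜 f w dbar y hy y' := by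
  change (algebraMap _ (ChartRing 𝒜 f w dbar y hy) v * IsLocalization.Away.invSelf (coverElement 𝒜 f w dbar y hy)) *
      algebraMap _ (ChartRing 𝒜 f w dbar y hy) (algebraMap B ↥(cobordantAlgebra f w) (y : B)) =
    algebraMap _ (ChartRing 𝒜 f w dbar y hy) (algebraMap B ↥(cobordantAlgebra f w) (y' : B))
  calc (algebraMap _ (ChartRing 𝒜 f w dbar y hy) v * IsLocalization.Away.invSelf (coverElement 𝒜 f w dbar y hy)) *
        algebraMap _ (ChartRing 𝒜 f w dbar y hy) (algebraMap B ↥(cobordantAlgebra f w) (y : B))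
      = algebraMap _ (ChartRing 𝒜 f w dbar y hy) (v * algebraMap B ↥(cobordantAlgebra f w) (y : B)) * IsLocalization.Away.invSelf (coverElement 𝒜 f w dbar y hy) := by
        rw [map_mul]; ring
    _ = algebraMap _ (ChartRing 𝒜 f w dbar y hy) (algebraMap B ↥(cobordantAlgebra f w) (y' : B)) *
          (algebraMap _ (ChartRing 𝒜 f w dbar y hy) (coverElement 𝒜 f w dbar y hy) * IsLocalization.Away.invSelf (coverElement 𝒜 f w dbar y hy)) := by
        rw [hv, map_mul]; ring
    _ = _ := by rw [IsLocalization.Away.mul_invSelf, mul_one]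

/-- ★ **The transition pin**: `(c′/c) · T(y) = T(y′)` in the chart ring of `c` for cover elements `c = yT^{dbar}`, `c′ = y′T^{dbar}`. -/
theorem coverElement_section_pin (y' : ↥(𝒜 0)) (hy' : y' ∈ (traceFiltration 𝒜 f w).ideal dbar) :
    (algebraMap _ (ChartRing 𝒜 f w dbar y hy) (coverElement 𝒜 f w dbar y' hy') * IsLocalization.Away.invSelf (coverElement 𝒜 f w dbar y hy)) *
        toChartRing 𝒜 f w dbar y hy y = toChartRing 𝒜 f w dbar y hy y' := by
  refine residualSection_pin r 𝒜 f w y hy _ y' (Subtype.ext ?_)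
  rw [MulMemClass.coe_mul, MulMemClass.coe_mul, coe_coverElement, coe_coverElement, cobordantAlgebra.coe_algebraMap, cobordantAlgebra.coe_algebraMap]
  ring

end Generic

end Summit.ResolutionOfSingularities.ResolutionOfSingularities.Theorems.WildQuotientResolution.S1.BlowupCharts

namespace Summit.ResolutionOfSingularities.ResolutionOfSingularities.Theorems.WildQuotientResolution.S1.GoodCharts

universe u

/-- ★ **An open with a separating section avoids the closure of a chart's zero set.** `W, U` opens of `V`, `t ∈ Γ(V, W)` with `W ∩ U ⊆ D(t)` and `tⁿ ∈ S`
(`n > 0`): then `U` is disjoint from `closure (V_W(S) ∩ W)`. [OURS · L1 W4.5c · `hWoff`/`hdisj` input of the parallel kill leaf; folklore] -/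
theorem disjoint_closure_zeroLocus_of_section {V : Scheme.{u}} (W U : V.Opens) (S : Set Γ(V, W)) (t : Γ(V, W)) {n : ℕ} (hn : 0 < n) (htS : t ^ n ∈ S)
    (htU : ∀ v ∈ W, v ∈ U → v ∈ V.basicOpen t) : Disjoint (U : Set V) (closure (V.zeroLocus (U := W) S ∩ (W : Set V))) := by
  refine Disjoint.closure_right ?_ U.isOpen
  rw [Set.disjoint_left]
  rintro v hvU ⟨hvZ, hvW⟩
  have hvt : v ∉ V.basicOpen t := by
    have := (Scheme.mem_zeroLocus_iff _ _ _).mp hvZ _ htS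
    rwa [Scheme.basicOpen_pow _ _ hn] at this
  exact hvt (htU v hvW hvU)

end Summit.ResolutionOfSingularities.ResolutionOfSingularities.Theorems.WildQuotientResolution.S1.GoodCharts

/-! ## The symmetric root: cover elements in `R^w`, bidegrees, residual sections -/

namespace Summit.ResolutionOfSingularities.ResolutionOfSingularities.Theorems.WildQuotientResolution.S1.KillCert.Sym

variable {k : Type} [Field k] {A : Type} [CommRing A] (δ : ℕ) (r : MvPolynomial (Fin 4) k) (e : A ≃+* MvPolynomial (Fin 4) k)
  (hr : e.symm r ∈ (weightedFiltration (e.symm ∘ ![X 0, X 1, X 2] : Fin 3 → A) ![δ + 1, 1, 1]).ideal (δ - 1)) (hδ : 1 ≤ δ) {p : ℕ}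
  {m : ℕ} (mo : Fin m → ℕ) (𝒜 : (Π j : Fin m, ZMod (mo j)) → AddSubgroup A) [GradedRing 𝒜]
  (hf : ∀ i, (e.symm ∘ ![X 0, X 1, X 2] : Fin 3 → A) i ∈ 𝒜 ((fun _ => (0 : Π j : Fin m, ZMod (mo j))) i)) (hr0 : e.symm r ∈ 𝒜 0)
  {dbar : ℕ} (y : ↥(𝒜 0)) (hy : y ∈ (traceFiltration 𝒜 (e.symm ∘ ![X 0, X 1, X 2] : Fin 3 → A) ![δ + 1, 1, 1]).ideal dbar)

/-- **Cover element 0 in `R^w`**: `c₀ = u₀′^{δdp}` when `(y₀ : A) = (e⁻¹x₀)^{δdp}` and `dbar = d·((δ+1)δp)`. -/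
theorem sym_coverElement_zero_eq (d : ℕ) (hdbar : dbar = d * ((δ + 1) * δ * p)) (hyval : (y : A) = e.symm (X 0) ^ (δ * (d * p))) :
    coverElement 𝒜 (e.symm ∘ ![X 0, X 1, X 2] : Fin 3 → A) ![δ + 1, 1, 1] dbar y hy = cobordantAlgebra.u' (e.symm ∘ ![X 0, X 1, X 2] : Fin 3 → A) ![δ + 1, 1, 1] 0 ^ (δ * (d * p)) := by
  symm
  refine Subtype.ext ?_
  rw [SubmonoidClass.coe_pow, cobordantAlgebra.coe_u', coe_coverElement, hyval, hdbar]
  change (LaurentPolynomial.C (e.symm (X 0)) * LaurentPolynomial.T ((δ + 1 : ℕ) : ℤ)) ^ (δ * (d * p)) = _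
  rw [mul_pow, ← map_pow, LaurentPolynomial.T_pow]
  congr 2
  push_cast
  ring

/-- **Norm cover element in `R^w`**: `c_j = (∏ᵢ (u_j″ + i·(u₀′ s^δ)))^{(δ+1)δd}` when `(y_j : A) = N_j^{(δ+1)δd}`, `N_j = ∏ᵢ (e⁻¹x_j + i e⁻¹x₀)`,
`dbar = d·((δ+1)δp)`; here `u_j″ = C(e⁻¹x_j)·T` is passed as any element `U` of `R^w` with that underlying Laurent polynomial. -/
theorem sym_coverElement_norm_eq [NeZero p] (d : ℕ) (hdbar : dbar = d * ((δ + 1) * δ * p)) (j : Fin 4)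
    (hyval : (y : A) = (∏ i : ZMod p, (e.symm (X j) + (i.val : A) * e.symm (X 0))) ^ ((δ + 1) * δ * d))
    (U : ↥(cobordantAlgebra (e.symm ∘ ![X 0, X 1, X 2] : Fin 3 → A) ![δ + 1, 1, 1])) (hU : (U : A[T;T⁻¹]) = LaurentPolynomial.C (e.symm (X j)) * LaurentPolynomial.T 1) :
    coverElement 𝒜 (e.symm ∘ ![X 0, X 1, X 2] : Fin 3 → A) ![δ + 1, 1, 1] dbar y hy =
      (∏ i : ZMod p, (U + algebraMap A _ (i.val : A) * (cobordantAlgebra.u' (e.symm ∘ ![X 0, X 1, X 2] : Fin 3 → A) ![δ + 1, 1, 1] 0 *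
        cobordantAlgebra.s (e.symm ∘ ![X 0, X 1, X 2] : Fin 3 → A) ![δ + 1, 1, 1] ^ δ))) ^ ((δ + 1) * δ * d) := by
  refine Subtype.ext ?_
  rw [SubmonoidClass.coe_pow, SubmonoidClass.coe_finsetProd, coe_coverElement, hyval, hdbar]
  have hi : ∀ i : ZMod p, ((U + algebraMap A _ (i.val : A) * (cobordantAlgebra.u' (e.symm ∘ ![X 0, X 1, X 2] : Fin 3 → A) ![δ + 1, 1, 1] 0 *
      cobordantAlgebra.s (e.symm ∘ ![X 0, X 1, X 2] : Fin 3 → A) ![δ + 1, 1, 1] ^ δ) : ↥(cobordantAlgebra (e.symm ∘ ![X 0, X 1, X 2] : Fin 3 → A) ![δ + 1, 1, 1])) : A[T;T⁻¹]) =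
      LaurentPolynomial.C (e.symm (X j)) * LaurentPolynomial.T 1 +
        (i.val : A[T;T⁻¹]) * (LaurentPolynomial.C (e.symm (X 0)) * LaurentPolynomial.T ((δ + 1 : ℕ) : ℤ) * LaurentPolynomial.T (-(δ : ℤ))) := by
    intro i
    rw [AddMemClass.coe_add, MulMemClass.coe_mul, MulMemClass.coe_mul, hU, cobordantAlgebra.coe_u', cobordantAlgebra.coe_s_pow, cobordantAlgebra.coe_algebraMap, map_natCast]
    rfl
  simp_rw [hi]
  rw [← sym_norm_T δ e (p := p) j, mul_pow, ← map_pow, LaurentPolynomial.T_pow]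
  congr 2
  push_cast
  ring

include hf in
/-- `u₀′ⁿ` has bidegree `((δ+1)n, 0)`. -/
theorem sym_u'_zero_pow_mem_reesPiece (n : ℕ) :
    cobordantAlgebra.u' (e.symm ∘ ![X 0, X 1, X 2] : Fin 3 → A) ![δ + 1, 1, 1] 0 ^ n ∈
      reesPiece 𝒜 (e.symm ∘ ![X 0, X 1, X 2] : Fin 3 → A) ![δ + 1, 1, 1] ((((δ + 1) * n : ℕ) : ℤ), (0 : Π j : Fin m, ZMod (mo j))) := by
  letI := reesGradedRing 𝒜 (e.symm ∘ ![X 0, X 1, X 2] : Fin 3 → A) ![δ + 1, 1, 1] hf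
  have h := SetLike.pow_mem_graded n (u'_mem_reesPiece 𝒜 (e.symm ∘ ![X 0, X 1, X 2] : Fin 3 → A) (δ := fun _ => 0) ![δ + 1, 1, 1] hf 0)
  have e1 : n • ((((![δ + 1, 1, 1] : Fin 3 → ℕ) 0 : ℕ) : ℤ), (fun _ => (0 : Π j : Fin m, ZMod (mo j))) 0) = ((((δ + 1) * n : ℕ) : ℤ), (0 : Π j : Fin m, ZMod (mo j))) := by
    refine Prod.ext ?_ ?_
    · change n • (((δ + 1 : ℕ) : ℤ)) = (((δ + 1) * n : ℕ) : ℤ); rw [nsmul_eq_mul]; push_cast; ring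
    · change n • (0 : Π j : Fin m, ZMod (mo j)) = 0; exact smul_zero _
  rwa [e1] at h

include hf hr0 hδ in
/-- `(u₁′ · r t^{δ−1})ⁿ` has bidegree `(δn, 0)`. -/
theorem sym_u'_one_mul_tail_pow_mem_reesPiece (n : ℕ) :
    (cobordantAlgebra.u' (e.symm ∘ ![X 0, X 1, X 2] : Fin 3 → A) ![δ + 1, 1, 1] 1 * ⟨_, C_mul_T_mem_cobordantAlgebra _ _ hr⟩) ^ n ∈
      reesPiece 𝒜 (e.symm ∘ ![X 0, X 1, X 2] : Fin 3 → A) ![δ + 1, 1, 1] (((δ * n : ℕ) : ℤ), (0 : Π j : Fin m, ZMod (mo j))) := by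
  letI := reesGradedRing 𝒜 (e.symm ∘ ![X 0, X 1, X 2] : Fin 3 → A) ![δ + 1, 1, 1] hf
  have h1 := u'_mem_reesPiece 𝒜 (e.symm ∘ ![X 0, X 1, X 2] : Fin 3 → A) (δ := fun _ => 0) ![δ + 1, 1, 1] hf 1
  have h2 := mk_mem_reesPiece 𝒜 (e.symm ∘ ![X 0, X 1, X 2] : Fin 3 → A) ![δ + 1, 1, 1] hr0 (C_mul_T_mem_cobordantAlgebra _ _ hr)
  have h := SetLike.pow_mem_graded n (SetLike.mul_mem_graded h1 h2)
  have e1 : n • (((((![δ + 1, 1, 1] : Fin 3 → ℕ) 1 : ℕ) : ℤ), (fun _ => (0 : Π j : Fin m, ZMod (mo j))) 1) + (((δ - 1 : ℕ) : ℤ), (0 : Π j : Fin m, ZMod (mo j)))) =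
      (((δ * n : ℕ) : ℤ), (0 : Π j : Fin m, ZMod (mo j))) := by
    refine Prod.ext ?_ ?_
    · change n • ((((1 : ℕ) : ℤ)) + ((δ - 1 : ℕ) : ℤ)) = ((δ * n : ℕ) : ℤ)
      rw [nsmul_eq_mul]; push_cast [hδ]; ring
    · change n • ((0 : Π j : Fin m, ZMod (mo j)) + 0) = 0; rw [add_zero]; exact smul_zero _
  rwa [e1] at h

include hf in
/-- ★ **Residual section 0** on the chart of `c = yT^{dbar}` (`dbar = d·((δ+1)δp)`): `u₀′^{δdp}/c` has degree `0` and lies in `𝔞·R_c` for every ideal `𝔞 ∋ u₀′`. -/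
theorem sym_residualSection_zero (d : ℕ) (hdbar : dbar = d * ((δ + 1) * δ * p)) (𝔞 : Ideal ↥(cobordantAlgebra (e.symm ∘ ![X 0, X 1, X 2] : Fin 3 → A) ![δ + 1, 1, 1]))
    (h𝔞 : cobordantAlgebra.u' (e.symm ∘ ![X 0, X 1, X 2] : Fin 3 → A) ![δ + 1, 1, 1] 0 ∈ 𝔞) (hn : 0 < δ * (d * p)) :
    algebraMap _ (ChartRing 𝒜 (e.symm ∘ ![X 0, X 1, X 2] : Fin 3 → A) ![δ + 1, 1, 1] dbar y hy)
          (cobordantAlgebra.u' (e.symm ∘ ![X 0, X 1, X 2] : Fin 3 → A) ![δ + 1, 1, 1] 0 ^ (δ * (d * p))) *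
        IsLocalization.Away.invSelf (coverElement 𝒜 (e.symm ∘ ![X 0, X 1, X 2] : Fin 3 → A) ![δ + 1, 1, 1] dbar y hy) ∈
        chartNodeGrading mo 𝒜 (e.symm ∘ ![X 0, X 1, X 2] : Fin 3 → A) ![δ + 1, 1, 1] hf dbar y hy 0 ∧
      algebraMap _ (ChartRing 𝒜 (e.symm ∘ ![X 0, X 1, X 2] : Fin 3 → A) ![δ + 1, 1, 1] dbar y hy)
          (cobordantAlgebra.u' (e.symm ∘ ![X 0, X 1, X 2] : Fin 3 → A) ![δ + 1, 1, 1] 0 ^ (δ * (d * p))) *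
        IsLocalization.Away.invSelf (coverElement 𝒜 (e.symm ∘ ![X 0, X 1, X 2] : Fin 3 → A) ![δ + 1, 1, 1] dbar y hy) ∈
        𝔞.map (algebraMap _ (ChartRing 𝒜 (e.symm ∘ ![X 0, X 1, X 2] : Fin 3 → A) ![δ + 1, 1, 1] dbar y hy)) := by
  refine ⟨residualSection_mem_chartNodeGrading_zero mo 𝒜 _ _ hf y hy ?_, residualSection_mem_map mo 𝒜 _ _ y hy (Ideal.pow_mem_of_mem 𝔞 h𝔞 _ hn)⟩
  have h := sym_u'_zero_pow_mem_reesPiece δ e mo 𝒜 hf (δ * (d * p))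
  have e1 : (δ + 1) * (δ * (d * p)) = dbar := by rw [hdbar]; ring
  rwa [e1] at h

include hf hr0 hδ in
/-- ★ **Residual section 1** on the chart of `c = yT^{dbar}` (`dbar = d·((δ+1)δp)`): `(u₁′ · r t^{δ−1})^{(δ+1)dp}/c` has degree `0` and lies in `𝔞·R_c` for
every ideal `𝔞 ∋ u₁′ · r t^{δ−1}`. -/
theorem sym_residualSection_one (d : ℕ) (hdbar : dbar = d * ((δ + 1) * δ * p)) (𝔞 : Ideal ↥(cobordantAlgebra (e.symm ∘ ![X 0, X 1, X 2] : Fin 3 → A) ![δ + 1, 1, 1]))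
    (h𝔞 : cobordantAlgebra.u' (e.symm ∘ ![X 0, X 1, X 2] : Fin 3 → A) ![δ + 1, 1, 1] 1 * ⟨_, C_mul_T_mem_cobordantAlgebra _ _ hr⟩ ∈ 𝔞) (hn : 0 < (δ + 1) * (d * p)) :
    algebraMap _ (ChartRing 𝒜 (e.symm ∘ ![X 0, X 1, X 2] : Fin 3 → A) ![δ + 1, 1, 1] dbar y hy)
          ((cobordantAlgebra.u' (e.symm ∘ ![X 0, X 1, X 2] : Fin 3 → A) ![δ + 1, 1, 1] 1 * ⟨_, C_mul_T_mem_cobordantAlgebra _ _ hr⟩) ^ ((δ + 1) * (d * p))) *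
        IsLocalization.Away.invSelf (coverElement 𝒜 (e.symm ∘ ![X 0, X 1, X 2] : Fin 3 → A) ![δ + 1, 1, 1] dbar y hy) ∈
        chartNodeGrading mo 𝒜 (e.symm ∘ ![X 0, X 1, X 2] : Fin 3 → A) ![δ + 1, 1, 1] hf dbar y hy 0 ∧
      algebraMap _ (ChartRing 𝒜 (e.symm ∘ ![X 0, X 1, X 2] : Fin 3 → A) ![δ + 1, 1, 1] dbar y hy)
          ((cobordantAlgebra.u' (e.symm ∘ ![X 0, X 1, X 2] : Fin 3 → A) ![δ + 1, 1, 1] 1 * ⟨_, C_mul_T_mem_cobordantAlgebra _ _ hr⟩) ^ ((δ + 1) * (d * p))) *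
        IsLocalization.Away.invSelf (coverElement 𝒜 (e.symm ∘ ![X 0, X 1, X 2] : Fin 3 → A) ![δ + 1, 1, 1] dbar y hy) ∈
        𝔞.map (algebraMap _ (ChartRing 𝒜 (e.symm ∘ ![X 0, X 1, X 2] : Fin 3 → A) ![δ + 1, 1, 1] dbar y hy)) := by
  refine ⟨residualSection_mem_chartNodeGrading_zero mo 𝒜 _ _ hf y hy ?_, residualSection_mem_map mo 𝒜 _ _ y hy (Ideal.pow_mem_of_mem 𝔞 h𝔞 _ hn)⟩
  have h := sym_u'_one_mul_tail_pow_mem_reesPiece δ r e hr hδ mo 𝒜 hf hr0 ((δ + 1) * (d * p))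
  have e1 : δ * ((δ + 1) * (d * p)) = dbar := by rw [hdbar]; ring
  rwa [e1] at h

end Summit.ResolutionOfSingularities.ResolutionOfSingularities.Theorems.WildQuotientResolution.S1.KillCert.Sym

end
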